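import Summits.Ventures.WeilGRH.TwistedWindowMeasureGrowth
import Mathlib.MeasureTheory.Integral.Prod
import HarnessLib

/-!
# GRH arm (rh-explicit, venture WeilGRH): THE MEAN DEFECT OF THE FLAT-WINDOW RUNG INEQUALITY IS THE SECOND
  INVERSE SPECTRAL MOMENT — `(1/A)∫₀^A a·[log q − K_κ + I_κ(a)/a − 2S_χ(a) − 2a·μ{0}] da → ∫ t⁻² dμ`

Cell `rh-explicit`, WEIL TRACK (structure seat weil-3, gen9).  `FlatWindowSpectral.lean` says the defect
`D(a) = log q − K_κ + I_κ(a)/a − 2S_χ(a) − 2a·μ{0}` of the flat-window rung inequality at window `a` is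
`≥ 0` and `≤ (2/a)∫t⁻²dμ`.  HERE: the defect is EXACTLY `D(a) = ∫ 2sin²(at)/(at²) dμ(t)`
(`flatWindow_defect_eq`), so `a·D(a) = ∫ 2sin²(at)/t² dμ` is an almost periodic function of the window,
and its Cesàro mean over the window is the second inverse moment of the spectral measure:

* `sigmaFinite_of_integrable_inv_one_add_sq`: a measure integrating `(1+t²)⁻¹` is σ-finite;
* `integral_two_mul_sin_sq`, `average_fejer_eq`: `(1/A)∫₀^A 2sin²(at)/t² da = t⁻²(1 − sin(2At)/(2At))`;
* `tendsto_integral_average_fejer`: `∫ t⁻²(1 − sin(2At)/(2At)) dμ → ∫ t⁻² dμ` (dominated convergence);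
* `intervalIntegral_integral_fejer_swap`: Fubini over `[0, A] × ℝ` (domination by `2t⁻²`);
* **`tendsto_average_defect`**: for `χ` mod `q ≠ 1` and EVERY positive `μ` representing `Q_χ` on all tests
  with `t⁻² ∈ L¹(μ)`: **`(1/A)∫₀^A a·D(a) da → ∫ t⁻² dμ`** as `A → ∞`.

So the one-window rung inequalities are sharp to `O(1/a)` and NOT to `o(1/a)`: the mean of `a·D(a)` is
`M₂ = ∫t⁻²dμ` (under `GRH(χ)`: `Σ_ρ m(ρ)/γ²`; for `ζ` under RH `Σ_ρ 1/γ² = 0.046`, and the 13 observed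
values of `a·D(a)`, `a ∈ [0.55, 6]`, average `0.047` — structure seat numerics tools/flatasym.py, kit j193572).

No definitions, no named facts, RH/GRH-free.
-/

set_option autoImplicit false

noncomputable section

open Complex Filter Set MeasureTheory
open scoped Real Topology ComplexConjugate ArithmeticFunction.vonMangoldt

namespace Summit.Ventures.WeilGRH

open Literature.NumberTheory.LFunctions
open Literature.NumberTheory.LFunctions.Yoshida1992 (chi)

variable {q : ℕ} {a : ℝ}

/-! ## The defect of one window as a Fejér integral without the atom -/

/-- `‖χ̂_0(½+it)‖² = 2a·𝟙_{0}(t) + 2sin²(at)/(at²)` EXACTLY (Lean's `0⁻¹ = 0` at the centre). -/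
theorem norm_sq_weilMellin_chi_zero_eq_indicator_add (ha : 0 < a) (t : ℝ) :
    ‖weilMellin (chi a 0) (1 / 2 + t * I)‖ ^ 2 =
      ({0} : Set ℝ).indicator (fun _ ↦ 2 * a) t + 2 * Real.sin (a * t) ^ 2 / (a * t ^ 2) := by
  rcases eq_or_ne t 0 with rfl | ht
  · rw [indicator_of_mem (mem_singleton _), norm_sq_weilMellin_chi_zero_zero ha]; simp
  · rw [indicator_of_notMem (by simpa using ht), zero_add, norm_sq_weilMellin_chi_zero ha ht]

/-- **The defect of the flat-window rung inequality at window `a`, atom removed**: for `χ` mod `q ≠ 1`,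
`a > 0`, every positive `μ` representing `Q_χ` on the tests of `[-a, a]`:
`log q − K_κ + I_κ(a)/a − 2S_χ(a) − 2a·μ{0} = ∫ 2sin²(at)/(at²) dμ(t)` (integrand `0` at the centre),
and the integrand is `μ`-integrable. -/
theorem flatWindow_defect_eq (hq : q ≠ 1) (χ : DirichletCharacter ℂ q) (ha : 0 < a) {μ : Measure ℝ}
    (hμ : ∀ g : ℝ → ℂ, IsWeilTest g → tsupport g ⊆ Icc (-a) a →
      Integrable (fun t : ℝ ↦ ‖weilMellin g (1 / 2 + t * I)‖ ^ 2) μ ∧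
        weilQuadraticChar χ g = ((∫ t, ‖weilMellin g (1 / 2 + t * I)‖ ^ 2 ∂μ : ℝ) : ℂ)) :
    Integrable (fun t : ℝ ↦ 2 * Real.sin (a * t) ^ 2 / (a * t ^ 2)) μ ∧
      Real.log q -
          (Real.log (4 * π) + Real.eulerMascheroniConstant +
            2 * ∫ t in Ioi (0 : ℝ), weilKillingDensityPar (charParity χ) t) +
          1 / a * (∫ t in Ioi (0 : ℝ), weilArchDensityPar (charParity χ) t * min t (2 * a)) -
          2 * (∑ n ∈ weilPrimeIndex a,
            (Λ n : ℝ) / Real.sqrt n * ((1 - Real.log n / (2 * a)) * (χ (n : ZMod q)).re)) -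
          2 * a * μ.real {0} =
        ∫ t, 2 * Real.sin (a * t) ^ 2 / (a * t ^ 2) ∂μ := by
  have hI := integrable_inv_one_add_sq_of_represents χ ha hμ
  obtain ⟨hint, heq⟩ := flatWindow_eq_log_sub_integral hq χ ha hμ hI
  have h0 := measure_zero_lt_top_of_integrable hI
  have hind : Integrable (fun t : ℝ ↦ ({0} : Set ℝ).indicator (fun _ ↦ 2 * a) t) μ :=
    (integrable_indicator_iff (measurableSet_singleton 0)).2 (integrableOn_const h0.ne)
  have hdecomp : (fun t : ℝ ↦ ‖weilMellin (chi a 0) (1 / 2 + t * I)‖ ^ 2) =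
      fun t ↦ ({0} : Set ℝ).indicator (fun _ ↦ 2 * a) t + 2 * Real.sin (a * t) ^ 2 / (a * t ^ 2) :=
    funext (norm_sq_weilMellin_chi_zero_eq_indicator_add ha)
  have hF : Integrable (fun t : ℝ ↦ 2 * Real.sin (a * t) ^ 2 / (a * t ^ 2)) μ := by
    have h := hint.sub hind
    refine h.congr (Eventually.of_forall fun t ↦ ?_)
    show ‖weilMellin (chi a 0) (1 / 2 + t * I)‖ ^ 2 - ({0} : Set ℝ).indicator (fun _ ↦ 2 * a) t = _
    rw [norm_sq_weilMellin_chi_zero_eq_indicator_add ha]; ring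
  refine ⟨hF, ?_⟩
  rw [hdecomp, integral_add hind hF, integral_indicator_const _ (measurableSet_singleton 0), smul_eq_mul] at heq
  linarith

/-! ## Measures integrating `(1+t²)⁻¹` are σ-finite; the window average of the Fejér kernel -/

/-- A measure on `ℝ` integrating `(1 + t²)⁻¹` is σ-finite (it is finite on every `[-n, n]`). -/
theorem sigmaFinite_of_integrable_inv_one_add_sq {μ : Measure ℝ}
    (hI : Integrable (fun t : ℝ ↦ (1 + t ^ 2)⁻¹) μ) : SigmaFinite μ := by
  refine ⟨⟨⟨fun n ↦ Icc (-(n : ℝ)) n, fun _ ↦ trivial, fun n ↦ ?_, ?_⟩⟩⟩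
  · -- `μ [-n, n] ≤ μ {t : (1+n²)⁻¹ ≤ (1+t²)⁻¹} < ∞`
    have hε : (0 : ℝ) < (1 + (n : ℝ) ^ 2)⁻¹ := by positivity
    refine lt_of_le_of_lt (measure_mono fun t ht ↦ ?_) (hI.measure_norm_ge_lt_top hε)
    obtain ⟨h1, h2⟩ := ht
    show (1 + (n : ℝ) ^ 2)⁻¹ ≤ ‖(1 + t ^ 2)⁻¹‖
    rw [Real.norm_of_nonneg (by positivity)]
    exact inv_anti₀ (by positivity) (by nlinarith [abs_le.2 ⟨h1, h2⟩, sq_abs t])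
  · refine iUnion_eq_univ_iff.2 fun t ↦ ?_
    obtain ⟨n, hn⟩ := exists_nat_ge |t|
    exact ⟨n, abs_le.1 hn⟩

/-- `∫₀^A 2 sin²(at) da = A − sin(2At)/(2t)` (`t ≠ 0`; `2sin² = 1 − cos`). -/
theorem integral_two_mul_sin_sq {t : ℝ} (ht : t ≠ 0) (A : ℝ) :
    ∫ a in (0 : ℝ)..A, 2 * Real.sin (a * t) ^ 2 = A - Real.sin (2 * A * t) / (2 * t) := by
  have hcos : ∀ a : ℝ, 2 * Real.sin (a * t) ^ 2 = 1 - Real.cos (2 * t * a) := by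
    intro a; rw [Real.sin_sq, Real.cos_sq]; ring_nf
  simp_rw [hcos]
  rw [intervalIntegral.integral_sub intervalIntegrable_const (by
      exact (Real.continuous_cos.comp (continuous_const.mul continuous_id)).intervalIntegrable _ _),
    intervalIntegral.integral_const, smul_eq_mul, mul_one, sub_zero,
    intervalIntegral.integral_comp_mul_left (fun x ↦ Real.cos x) (by positivity : (2 : ℝ) * t ≠ 0),
    integral_cos, smul_eq_mul]
  simp only [mul_zero, Real.sin_zero, sub_zero]
  rw [show 2 * t * A = 2 * A * t by ring]
  field_simp

/-- The window-averaged Fejér kernel: for `A > 0` and every `t`,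
`(1/A)∫₀^A 2sin²(at)/t² da = t⁻²(1 − sin(2At)/(2At))` (both sides `0` at `t = 0`). -/
theorem average_fejer_eq {A : ℝ} (hA : 0 < A) (t : ℝ) :
    1 / A * ∫ a in (0 : ℝ)..A, 2 * Real.sin (a * t) ^ 2 / t ^ 2 =
      (t ^ 2)⁻¹ * (1 - Real.sin (2 * A * t) / (2 * A * t)) := by
  rcases eq_or_ne t 0 with rfl | ht
  · simp
  · simp_rw [div_eq_mul_inv, intervalIntegral.integral_mul_const]
    rw [show (fun a : ℝ ↦ 2 * Real.sin (a * t) ^ 2) = fun a ↦ 2 * Real.sin (a * t) ^ 2 from rfl,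
      integral_two_mul_sin_sq ht A]
    field_simp

/-- `|1 − sin x/x| ≤ 2`. -/
theorem abs_one_sub_sin_div_le (x : ℝ) : |1 - Real.sin x / x| ≤ 2 := by
  rcases eq_or_ne x 0 with rfl | hx
  · simp
  · have h : |Real.sin x / x| ≤ 1 := by
      rw [abs_div, div_le_one (abs_pos.2 hx)]; exact Real.abs_sin_le_abs
    have h' := abs_le.1 h
    rw [abs_le]
    constructor <;> linarith

/-- **The window average of the Fejér integral tends to the second inverse moment**:
`∫ t⁻²(1 − sin(2At)/(2At)) dμ → ∫ t⁻² dμ` as `A → ∞` (`t⁻² ∈ L¹(μ)`; dominated convergence, `|1 − sin x/x| ≤ 2`). -/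
theorem tendsto_integral_average_fejer {μ : Measure ℝ} (hM : Integrable (fun t : ℝ ↦ (t ^ 2)⁻¹) μ) :
    Tendsto (fun A : ℝ ↦ ∫ t, (t ^ 2)⁻¹ * (1 - Real.sin (2 * A * t) / (2 * A * t)) ∂μ) atTop
      (𝓝 (∫ t, (t ^ 2)⁻¹ ∂μ)) := by
  refine tendsto_integral_filter_of_dominated_convergence (fun t ↦ 2 * (t ^ 2)⁻¹) ?_ ?_ (hM.const_mul 2) ?_
  · exact Eventually.of_forall fun A ↦ (by fun_prop : Measurable fun t : ℝ ↦
      (t ^ 2)⁻¹ * (1 - Real.sin (2 * A * t) / (2 * A * t))).aestronglyMeasurable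
  · refine Eventually.of_forall fun A ↦ ae_of_all _ fun t ↦ ?_
    rw [Real.norm_eq_abs, abs_mul, abs_of_nonneg (by positivity : (0 : ℝ) ≤ (t ^ 2)⁻¹), mul_comm]
    exact mul_le_mul_of_nonneg_right (abs_one_sub_sin_div_le _) (by positivity)
  · refine ae_of_all _ fun t ↦ ?_
    rcases eq_or_ne t 0 with rfl | ht
    · simp
    · have h1 : Tendsto (fun A : ℝ ↦ Real.sin (2 * A * t) / (2 * A * t)) atTop (𝓝 0) := by
        have hlim : Tendsto (fun A : ℝ ↦ 1 / (2 * |t| * A)) atTop (𝓝 0) :=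
          tendsto_const_nhds.div_atTop (tendsto_id.const_mul_atTop (by positivity))
        refine squeeze_zero_norm' ?_ hlim
        filter_upwards [eventually_gt_atTop (0 : ℝ)] with A hA
        rw [Real.norm_eq_abs, abs_div]
        have hx : 0 < |2 * A * t| := abs_pos.2 (mul_ne_zero (mul_ne_zero two_ne_zero hA.ne') ht)
        calc |Real.sin (2 * A * t)| / |2 * A * t| ≤ 1 / |2 * A * t| :=
              div_le_div_of_nonneg_right (Real.abs_sin_le_one _) hx.le
          _ = 1 / (2 * |t| * A) := by rw [abs_mul, abs_mul, abs_two, abs_of_pos hA]; ring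
      have h2 := ((tendsto_const_nhds (x := (1 : ℝ))).sub h1).const_mul (t ^ 2)⁻¹
      simpa using h2

/-! ## Fubini over the window variable, and the mean-defect theorem -/

/-- **Fubini for the Fejér integrand**: for `A ≥ 0` and a σ-finite `μ` with `t⁻² ∈ L¹(μ)`,
`∫₀^A (∫ 2sin²(at)/t² dμ) da = ∫ (∫₀^A 2sin²(at)/t² da) dμ` (domination by `2t⁻²` on `[0,A] × ℝ`). -/
theorem intervalIntegral_integral_fejer_swap {μ : Measure ℝ} [SFinite μ]
    (hM : Integrable (fun t : ℝ ↦ (t ^ 2)⁻¹) μ) {A : ℝ} (hA : 0 ≤ A) :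
    ∫ a in (0 : ℝ)..A, (∫ t, 2 * Real.sin (a * t) ^ 2 / t ^ 2 ∂μ) =
      ∫ t, (∫ a in (0 : ℝ)..A, 2 * Real.sin (a * t) ^ 2 / t ^ 2) ∂μ := by
  refine intervalIntegral_integral_swap ?_
  rw [Set.uIoc_of_le hA]
  have hfin : volume (Ioc (0 : ℝ) A) ≠ ⊤ := by rw [Real.volume_Ioc]; exact ENNReal.ofReal_ne_top
  have h1 : Integrable (fun _ : ℝ ↦ (1 : ℝ)) (volume.restrict (Ioc 0 A)) :=
    integrableOn_const (C := (1 : ℝ)) hfin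
  have hdom : Integrable (fun p : ℝ × ℝ ↦ (1 : ℝ) * (2 * (p.2 ^ 2)⁻¹)) ((volume.restrict (Ioc 0 A)).prod μ) :=
    h1.mul_prod (hM.const_mul 2)
  refine hdom.mono' ?_ (ae_of_all _ fun p ↦ ?_)
  · exact (by fun_prop : Measurable fun p : ℝ × ℝ ↦ 2 * Real.sin (p.1 * p.2) ^ 2 / p.2 ^ 2).aestronglyMeasurable
  · show ‖2 * Real.sin (p.1 * p.2) ^ 2 / p.2 ^ 2‖ ≤ 1 * (2 * (p.2 ^ 2)⁻¹)
    rw [Real.norm_of_nonneg (by positivity), one_mul, div_eq_mul_inv]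
    exact mul_le_mul_of_nonneg_right (by nlinarith [Real.sin_sq_le_one (p.1 * p.2)]) (by positivity)

/-- **THE MEAN DEFECT OF THE RUNG INEQUALITY IS THE SECOND INVERSE SPECTRAL MOMENT.**  Let `q ≠ 1` and let
`μ` represent `Q_χ` on every test (all windows; under `GRH(χ)` the zero heights of `L(s, χ)`), with
`t⁻² ∈ L¹(μ)`.  Writing `D(a) := log q − K_κ + I_κ(a)/a − 2S_χ(a) − 2a·μ{0} ≥ 0` for the defect of the
flat-window rung inequality at window `a` (atom removed),

  `(1/A) ∫₀^A a·D(a) da → ∫ t⁻² dμ(t)`   (`A → ∞`).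

So the rung inequalities are sharp to `O(1/a)` and NOT better: the defect `a·D(a) = ∫2sin²(at)/t²dμ` is an
almost periodic function of the window whose MEAN is exactly `M₂ = ∫t⁻²dμ` (`= Σ_ρ m(ρ)/γ²` under GRH;
`= 0.046` for `ζ` under RH, the mean of the observed `a·slack`). -/
theorem tendsto_average_defect (hq : q ≠ 1) (χ : DirichletCharacter ℂ q) {μ : Measure ℝ}
    (hμ : ∀ g : ℝ → ℂ, IsWeilTest g →
      Integrable (fun t : ℝ ↦ ‖weilMellin g (1 / 2 + t * I)‖ ^ 2) μ ∧
        weilQuadraticChar χ g = ((∫ t, ‖weilMellin g (1 / 2 + t * I)‖ ^ 2 ∂μ : ℝ) : ℂ))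
    (hM : Integrable (fun t : ℝ ↦ (t ^ 2)⁻¹) μ) :
    Tendsto (fun A : ℝ ↦ 1 / A * ∫ a in (0 : ℝ)..A,
        a * (Real.log q -
          (Real.log (4 * π) + Real.eulerMascheroniConstant +
            2 * ∫ t in Ioi (0 : ℝ), weilKillingDensityPar (charParity χ) t) +
          1 / a * (∫ t in Ioi (0 : ℝ), weilArchDensityPar (charParity χ) t * min t (2 * a)) -
          2 * (∑ n ∈ weilPrimeIndex a,
            (Λ n : ℝ) / Real.sqrt n * ((1 - Real.log n / (2 * a)) * (χ (n : ZMod q)).re)) -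
          2 * a * μ.real {0})) atTop
      (𝓝 (∫ t, (t ^ 2)⁻¹ ∂μ)) := by
  have hI : Integrable (fun t : ℝ ↦ (1 + t ^ 2)⁻¹) μ :=
    integrable_inv_one_add_sq_of_represents χ one_pos (fun g hg _ ↦ hμ g hg)
  haveI : SigmaFinite μ := sigmaFinite_of_integrable_inv_one_add_sq hI
  -- the integrand is `∫ 2sin²(at)/t² dμ` on `[0, A]`
  have hptw : ∀ a : ℝ, 0 ≤ a →
      a * (Real.log q -
          (Real.log (4 * π) + Real.eulerMascheroniConstant +
            2 * ∫ t in Ioi (0 : ℝ), weilKillingDensityPar (charParity χ) t) +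
          1 / a * (∫ t in Ioi (0 : ℝ), weilArchDensityPar (charParity χ) t * min t (2 * a)) -
          2 * (∑ n ∈ weilPrimeIndex a,
            (Λ n : ℝ) / Real.sqrt n * ((1 - Real.log n / (2 * a)) * (χ (n : ZMod q)).re)) -
          2 * a * μ.real {0}) = ∫ t, 2 * Real.sin (a * t) ^ 2 / t ^ 2 ∂μ := by
    intro a ha0
    rcases ha0.eq_or_lt with rfl | ha
    · simp
    · obtain ⟨hF, heq⟩ := flatWindow_defect_eq hq χ ha (fun g hg _ ↦ hμ g hg)
      rw [heq, ← integral_const_mul]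
      refine integral_congr_ae (Eventually.of_forall fun t ↦ ?_)
      show a * (2 * Real.sin (a * t) ^ 2 / (a * t ^ 2)) = 2 * Real.sin (a * t) ^ 2 / t ^ 2
      rcases eq_or_ne t 0 with rfl | ht
      · simp
      · field_simp
  have hev : ∀ᶠ A in atTop, ∫ t, (t ^ 2)⁻¹ * (1 - Real.sin (2 * A * t) / (2 * A * t)) ∂μ =
      1 / A * ∫ a in (0 : ℝ)..A,
        a * (Real.log q -
          (Real.log (4 * π) + Real.eulerMascheroniConstant +
            2 * ∫ t in Ioi (0 : ℝ), weilKillingDensityPar (charParity χ) t) +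
          1 / a * (∫ t in Ioi (0 : ℝ), weilArchDensityPar (charParity χ) t * min t (2 * a)) -
          2 * (∑ n ∈ weilPrimeIndex a,
            (Λ n : ℝ) / Real.sqrt n * ((1 - Real.log n / (2 * a)) * (χ (n : ZMod q)).re)) -
          2 * a * μ.real {0}) := by
    filter_upwards [eventually_gt_atTop (0 : ℝ)] with A hA
    rw [intervalIntegral.integral_congr (g := fun a ↦ ∫ t, 2 * Real.sin (a * t) ^ 2 / t ^ 2 ∂μ)
      (fun a ha ↦ hptw a (by rw [Set.uIcc_of_le hA.le] at ha; exact ha.1)),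
      intervalIntegral_integral_fejer_swap hM hA.le, ← integral_const_mul]
    refine integral_congr_ae (Eventually.of_forall fun t ↦ ?_)
    exact (average_fejer_eq hA t).symm
  exact (tendsto_integral_average_fejer hM).congr' hev

end Summit.Ventures.WeilGRH


end
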